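import Summits.Parity.GeneralizedHardyLittlewood.Theorems.GreenTaoLevelTwoMNTwoMajorArcLocal
import Summits.Parity.GeneralizedHardyLittlewood.Theorems.GreenTaoLevelTwoMNTwoLocalPiece
import Summits.Parity.GeneralizedHardyLittlewood.Theorems.GreenTaoLevelTwoMNTwoLocalQuadratic

/-!
# Route `GreenTaoLevelTwo`, crux `MNTwo` (stmt-Parity-21276), line `birth`, stub `stub_mnVertical`:
# §12 for one tent piece, in rotation-Bohr vocabulary (GT 2008b §12)

Block V6 of the `stub_mnVertical` census, CONCRETE PIECE ESTIMATE (B. Green, T. Tao, *Quadratic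
uniformity of the Möbius function*, Ann. Inst. Fourier 58 (2008) = arXiv:math/0606087, §12): the
abstract piece estimate `…MNTwoMajorArcLocal.norm_sum_moebius_major_arc_piece_le` instantiated with
the rotation Bohr gauge `ν(n) = ⨆ᵢ‖nαᵢ‖ + |n|/N` (`…MNTwoBohrGauge`), the shift set
`H = q·B_α(0,η)` (`shiftSet_spec`, density `(η/16)^{k+1}/2` by Lemma 14 (a)) and the tent pieces
`P_{a,j} = ψ·∏ᵢτ_{aᵢ}(nαᵢ)·τ_j(n/3N)` of `…MNTwoLocalPiece` (mesh `m`, gauge diameter `< 8/m`, shift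
bound `(1+km+m)ν`).  All parameters (`q, K, ρ, η, m`) are free; what is left for §12 is to sum over
the `m^{k+1}` pieces (`…MNTwoLocalPiece.sum_pieces_eq`) and to choose `η, m` as powers of `log N`.
Def-free.

* `norm_sum_moebius_major_arc_bohrPiece_le` — for every `k`, `A > 0` there is `C ≥ 0` with, for
  each piece, `‖Σ_{N<n≤2N} μ(n)P_{a,j}(n)e(−φ(n))‖ ≤ C q/√((η/16)^{k+1}/2) · N/log^A N
  + 2πKη(qη + 16/m) Σ P_{a,j} + N(1+km+m)·2qη`.

References: [GreenTao2008QuadraticMobius] arXiv:math/0606087 §12.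
-/

noncomputable section

open Finset Real ArithmeticFunction
open scoped ArithmeticFunction.Moebius

namespace Summit.Parity.GeneralizedHardyLittlewood.GreenTaoLevelTwoMNTwoMajorArcPiece

open Summit.Parity.GeneralizedHardyLittlewood.GreenTaoLevelTwoMNTwoMajorArcLocal
  (norm_sum_moebius_major_arc_piece_le)
open Summit.Parity.GeneralizedHardyLittlewood.GreenTaoLevelTwoMNTwoBohrGauge
  (bohrGauge_nonneg bohrGauge_zero bohrGauge_add_le shiftSet_spec)
open Summit.Parity.GeneralizedHardyLittlewood.GreenTaoLevelTwoMNTwoLocalPiece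
  (piece_nonneg_le piece_diam piece_shift)
open Summit.Parity.GeneralizedHardyLittlewood.GreenTaoLevelTwoMNTwoLocalQuadratic (gauge_nsmul_le)

/-- **§12 for one tent piece (GT 2008b §12, concrete form).**  See the module docstring: `φ`
locally quadratic on `B_α(n₀,R)` (eight-point form for the gauge `ν(n) = ⨆ᵢ‖nαᵢ‖ + |n|/N`) with the
major-arc bound `‖q•φ''(a,b)‖ ≤ Kν(a)ν(b)` on `ν < ρ`; `ψ` with `0 ≤ ψ ≤ 1`, supported in
`(N,2N] ∩ B_α(n₀,r₁)`, gauge-`1`-Lipschitz; parameters `1 ≤ q`, `0 ≤ K`, `0 < η ≤ 1`, `qη ≤ ρ`,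
`qη ≤ 1`, `1 ≤ m`, `8/m ≤ ρ`, `r₁ + 2ρ ≤ R`, `3ρ ≤ R`; piece index `a : Fin k → Fin m`, `j`.
[cite: GreenTao2008QuadraticMobius, §12] -/
theorem norm_sum_moebius_major_arc_bohrPiece_le (k : ℕ) {A : ℝ} (hA : 0 < A) :
    ∃ C : ℝ, 0 ≤ C ∧ ∀ N : ℕ, 2 ≤ N → ∀ (α : Fin k → ℝ) (n₀ : ℤ) (R K ρ r₁ η : ℝ) (q m : ℕ)
      (φ : ℤ → UnitAddCircle) (ψ : ℤ → ℝ) (a : Fin k → Fin m) (j : ℕ),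
      (∀ n u b c : ℤ,
        (⨆ i : Fin k, ‖((((n - n₀ : ℤ) : ℝ) * α i : ℝ) : AddCircle (1 : ℝ))‖) +
            |((n - n₀ : ℤ) : ℝ)| / N < R →
        (⨆ i : Fin k, ‖((((n + u - n₀ : ℤ) : ℝ) * α i : ℝ) : AddCircle (1 : ℝ))‖) +
            |((n + u - n₀ : ℤ) : ℝ)| / N < R →
        (⨆ i : Fin k, ‖((((n + b - n₀ : ℤ) : ℝ) * α i : ℝ) : AddCircle (1 : ℝ))‖) +
            |((n + b - n₀ : ℤ) : ℝ)| / N < R →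
        (⨆ i : Fin k, ‖((((n + c - n₀ : ℤ) : ℝ) * α i : ℝ) : AddCircle (1 : ℝ))‖) +
            |((n + c - n₀ : ℤ) : ℝ)| / N < R →
        (⨆ i : Fin k, ‖((((n + u + b - n₀ : ℤ) : ℝ) * α i : ℝ) : AddCircle (1 : ℝ))‖) +
            |((n + u + b - n₀ : ℤ) : ℝ)| / N < R →
        (⨆ i : Fin k, ‖((((n + u + c - n₀ : ℤ) : ℝ) * α i : ℝ) : AddCircle (1 : ℝ))‖) +
            |((n + u + c - n₀ : ℤ) : ℝ)| / N < R →
        (⨆ i : Fin k, ‖((((n + b + c - n₀ : ℤ) : ℝ) * α i : ℝ) : AddCircle (1 : ℝ))‖) +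
            |((n + b + c - n₀ : ℤ) : ℝ)| / N < R →
        (⨆ i : Fin k, ‖((((n + u + b + c - n₀ : ℤ) : ℝ) * α i : ℝ) : AddCircle (1 : ℝ))‖) +
            |((n + u + b + c - n₀ : ℤ) : ℝ)| / N < R →
        φ (n + u + b + c) - φ (n + u + b) - φ (n + u + c) - φ (n + b + c)
          + φ (n + u) + φ (n + b) + φ (n + c) - φ n = 0) →
      1 ≤ q → 0 ≤ K → 0 < η → η ≤ 1 → (q : ℝ) * η ≤ ρ → (q : ℝ) * η ≤ 1 → 1 ≤ m →
      (8 : ℝ) / m ≤ ρ → r₁ + 2 * ρ ≤ R → 3 * ρ ≤ R →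
      (∀ u b : ℤ,
        (⨆ i : Fin k, ‖(((u : ℝ) * α i : ℝ) : AddCircle (1 : ℝ))‖) + |(u : ℝ)| / N < ρ →
        (⨆ i : Fin k, ‖(((b : ℝ) * α i : ℝ) : AddCircle (1 : ℝ))‖) + |(b : ℝ)| / N < ρ →
        ‖q • (φ (n₀ + u + b) - φ (n₀ + u) - φ (n₀ + b) + φ n₀)‖ ≤
          K * ((⨆ i : Fin k, ‖(((u : ℝ) * α i : ℝ) : AddCircle (1 : ℝ))‖) + |(u : ℝ)| / N) *
            ((⨆ i : Fin k, ‖(((b : ℝ) * α i : ℝ) : AddCircle (1 : ℝ))‖) + |(b : ℝ)| / N)) →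
      (∀ n, 0 ≤ ψ n) → (∀ n, ψ n ≤ 1) → (∀ n, ψ n ≠ 0 → (N : ℤ) < n ∧ n ≤ 2 * N) →
      (∀ n, ψ n ≠ 0 →
        (⨆ i : Fin k, ‖((((n - n₀ : ℤ) : ℝ) * α i : ℝ) : AddCircle (1 : ℝ))‖) +
          |((n - n₀ : ℤ) : ℝ)| / N < r₁) →
      (∀ n n' : ℤ, |ψ n - ψ n'| ≤
        (⨆ i : Fin k, ‖((((n - n' : ℤ) : ℝ) * α i : ℝ) : AddCircle (1 : ℝ))‖) +
          |((n - n' : ℤ) : ℝ)| / N) →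
      ‖∑ n ∈ Ioc N (2 * N), ((μ n : ℝ) : ℂ) *
          ((ψ n * (∏ i, max 0 (1 - (m : ℝ) *
              ‖((((n : ℤ) : ℝ) * α i - ((a i : ℕ) : ℝ) / m : ℝ) : AddCircle (1 : ℝ))‖)) *
            max 0 (1 - (m : ℝ) * ‖((((n : ℤ) : ℝ) / (3 * N) - (j : ℝ) / m : ℝ) : AddCircle (1 : ℝ))‖)
            : ℝ) : ℂ) * ((AddCircle.toCircle (-φ n) : Circle) : ℂ)‖ ≤
        C * q / Real.sqrt ((η / 16) ^ (k + 1) / 2) * N / Real.log N ^ A +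
          2 * Real.pi * (K * η * (q * η + 4 * (4 / m))) *
            ∑ n ∈ Ioc N (2 * N), (ψ n * (∏ i, max 0 (1 - (m : ℝ) *
              ‖((((n : ℤ) : ℝ) * α i - ((a i : ℕ) : ℝ) / m : ℝ) : AddCircle (1 : ℝ))‖)) *
              max 0 (1 - (m : ℝ) * ‖((((n : ℤ) : ℝ) / (3 * N) - (j : ℝ) / m : ℝ) : AddCircle (1 : ℝ))‖)) +
          N * ((1 + k * m + m) * (2 * q * η)) := by
  obtain ⟨C, hC0, hC⟩ := norm_sum_moebius_major_arc_piece_le hA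
  refine ⟨C, hC0, ?_⟩
  intro N hN α n₀ R K ρ r₁ η q m φ ψ a j hφ hq hK hη hη1 hqη hqη1 hm h8m hR hρR hMA hψ0 hψ1 hsupp
    hloc hlip
  classical
  have hN1 : 1 ≤ N := by omega
  have hNr : (0 : ℝ) < N := by exact_mod_cast (show 0 < N by omega)
  have hm0 : 0 < m := by omega
  have hmr : (0 : ℝ) < m := by exact_mod_cast hm0
  -- the gauge and its axioms
  set ν : ℤ → ℝ := fun n => (⨆ i : Fin k, ‖(((n : ℝ) * α i : ℝ) : AddCircle (1 : ℝ))‖) + |(n : ℝ)| / N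
    with hνdef
  have hν0 : ν 0 = 0 := bohrGauge_zero α N
  have hνnn : ∀ x, 0 ≤ ν x := fun x => bohrGauge_nonneg α N x
  have hνadd : ∀ x y, ν (x + y) ≤ ν x + ν y := fun x y => bohrGauge_add_le α N x y
  -- the shift set
  obtain ⟨h0H, hcard, hmem⟩ := shiftSet_spec α hN1 hq hη hη1
  set H := ((Finset.Ioo (-(N : ℤ)) N).filter fun a : ℤ =>
      (∀ i, ‖(((a : ℝ) * α i : ℝ) : AddCircle (1 : ℝ))‖ + |(a : ℝ)| / N < η) ∧ |(a : ℝ)| / N < η).image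
        fun a : ℤ => (q : ℤ) * a with hHdef
  set δ : ℝ := (η / 16) ^ (k + 1) / 2 with hδ
  have hδpos : 0 < δ := by positivity
  have hδN : δ * N ≤ #H := by
    have e : δ * N = (η / 16) ^ (k + 1) * N / 2 := by rw [hδ]; ring
    rw [e]; exact hcard
  have hH : ∀ h ∈ H, |h| ≤ (N : ℤ) ∧ ∃ a : ℤ, h = q * a ∧ ν a < η := by
    intro h hh
    obtain ⟨habs, a', ha', hga⟩ := hmem h hh
    refine ⟨?_, a', ha', hga⟩
    have h1 : |(h : ℝ)| ≤ N := by
      refine habs.trans ?_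
      have : (q : ℝ) * η * N ≤ 1 * N := mul_le_mul_of_nonneg_right hqη1 hNr.le
      linarith
    have h2 : ((|h| : ℤ) : ℝ) ≤ (N : ℝ) := by push_cast; exact h1
    exact_mod_cast h2
  -- the piece and its properties
  set P : ℤ → ℝ := fun n => ψ n * (∏ i, max 0 (1 - (m : ℝ) *
      ‖((((n : ℤ) : ℝ) * α i - ((a i : ℕ) : ℝ) / m : ℝ) : AddCircle (1 : ℝ))‖)) *
    max 0 (1 - (m : ℝ) * ‖((((n : ℤ) : ℝ) / (3 * N) - (j : ℝ) / m : ℝ) : AddCircle (1 : ℝ))‖)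
    with hPdef
  have hPψ : ∀ n, 0 ≤ P n ∧ P n ≤ ψ n := fun n => piece_nonneg_le α N ψ hψ0 a j n
  have hP0 : ∀ n, 0 ≤ P n := fun n => (hPψ n).1
  have hP1 : ∀ n, P n ≤ 1 := fun n => (hPψ n).2.trans (hψ1 n)
  have hPne : ∀ n, P n ≠ 0 → ψ n ≠ 0 := by
    intro n hn hψn; apply hn; simp only [hPdef, hψn, zero_mul]
  have hPsupp : ∀ n, P n ≠ 0 → (N : ℤ) < n ∧ n ≤ 2 * N := fun n hn => hsupp n (hPne n hn)
  have hPloc : ∀ n, P n ≠ 0 → ν (n - n₀) < r₁ := fun n hn => hloc n (hPne n hn)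
  have hPdiam : ∀ n n', P n ≠ 0 → P n' ≠ 0 → ν (n - n') < 2 * (4 / m) := by
    intro n n' hn hn'
    have h1 := hPsupp n hn; have h2 := hPsupp n' hn'
    have hnn' : |((n - n' : ℤ) : ℝ)| ≤ N := by
      rw [abs_le]; push_cast
      constructor
      · have : (n' : ℝ) ≤ 2 * N := by exact_mod_cast h2.2
        have : (N : ℝ) < n := by exact_mod_cast h1.1
        linarith
      · have : (n : ℝ) ≤ 2 * N := by exact_mod_cast h1.2
        have : (N : ℝ) < n' := by exact_mod_cast h2.1
        linarith
    have := piece_diam hm0 α hN1 ψ a j hnn' hn hn'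
    have e : (2 : ℝ) * (4 / m) = 8 / m := by ring
    rw [e]; exact this
  -- the shift bound
  set w : ℤ → ℝ := fun _ => (1 + k * m + m) * (2 * q * η) with hwdef
  have hw0 : ∀ n, 0 ≤ w n := fun n => by simp only [hwdef]; positivity
  have hνH : ∀ h ∈ H, ν h ≤ q * η := by
    intro h hh
    obtain ⟨_, a', rfl, hga⟩ := hH h hh
    have := gauge_nsmul_le ν hν0 hνadd a' q
    have hq0 : (0 : ℝ) ≤ q := Nat.cast_nonneg _
    nlinarith
  have hw : ∀ n, ∀ h₁ ∈ H, ∀ h₂ ∈ H, |P (n + h₁ + h₂) - P n| ≤ w n := by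
    intro n h₁ hh₁ h₂ hh₂
    have hs := piece_shift α hN1 ψ hψ0 hψ1 hlip a j n (h₁ + h₂)
    have e1 : n + (h₁ + h₂) = n + h₁ + h₂ := by ring
    rw [e1] at hs
    have hgauge : (⨆ i : Fin k, ‖((((h₁ + h₂ : ℤ) : ℝ) * α i : ℝ) : AddCircle (1 : ℝ))‖) +
        |((h₁ + h₂ : ℤ) : ℝ)| / N ≤ q * η + q * η := by
      have := hνadd h₁ h₂
      have e2 : ν (h₁ + h₂) = (⨆ i : Fin k, ‖((((h₁ + h₂ : ℤ) : ℝ) * α i : ℝ) : AddCircle (1 : ℝ))‖) +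
          |((h₁ + h₂ : ℤ) : ℝ)| / N := rfl
      rw [← e2]
      linarith [hνH h₁ hh₁, hνH h₂ hh₂]
    have hcoef : (0 : ℝ) ≤ 1 + k * m + m := by positivity
    have hs' : |P (n + h₁ + h₂) - P n| ≤ (1 + k * m + m) *
        ((⨆ i : Fin k, ‖((((h₁ + h₂ : ℤ) : ℝ) * α i : ℝ) : AddCircle (1 : ℝ))‖) +
          |((h₁ + h₂ : ℤ) : ℝ)| / N) := hs
    refine hs'.trans ?_
    simp only [hwdef]
    nlinarith
  -- apply the abstract piece estimate
  have h8 : 2 * (4 / (m : ℝ)) ≤ ρ := by rw [show (2 : ℝ) * (4 / m) = 8 / m by ring]; exact h8m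
  have hr0 : (0 : ℝ) ≤ 4 / m := by positivity
  have hMA' : ∀ u b : ℤ, ν u < ρ → ν b < ρ →
      ‖q • (φ (n₀ + u + b) - φ (n₀ + u) - φ (n₀ + b) + φ n₀)‖ ≤ K * ν u * ν b := by
    intro u b hu hb
    exact hMA u b hu hb
  have hφ' : ∀ n u b c : ℤ, ν (n - n₀) < R → ν (n + u - n₀) < R → ν (n + b - n₀) < R →
      ν (n + c - n₀) < R → ν (n + u + b - n₀) < R → ν (n + u + c - n₀) < R →
      ν (n + b + c - n₀) < R → ν (n + u + b + c - n₀) < R →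
      φ (n + u + b + c) - φ (n + u + b) - φ (n + u + c) - φ (n + b + c)
        + φ (n + u) + φ (n + b) + φ (n + c) - φ n = 0 := by
    intro n u b c h1 h2 h3 h4 h5 h6 h7 h8'
    exact hφ n u b c h1 h2 h3 h4 h5 h6 h7 h8'
  have main := hC N hN q hq ν hν0 hνnn hνadd φ n₀ R K ρ r₁ (4 / m) η hφ' hK hη hMA' hR hρR hr0 h8
    hqη H δ hδpos hδN h0H hH P w hP0 hP1 hPsupp hPloc hPdiam hw0 hw
  have hsumw : ∑ n ∈ Ioc N (2 * N), w n = N * ((1 + k * m + m) * (2 * q * η)) := by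
    simp only [hwdef, Finset.sum_const, Nat.card_Ioc, nsmul_eq_mul, show 2 * N - N = N by omega]
  rw [hsumw] at main
  exact main

end Summit.Parity.GeneralizedHardyLittlewood.GreenTaoLevelTwoMNTwoMajorArcPiece
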